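import Mathlib
import HarnessLib
import Literature.Analysis.PDE.DivFormLiouville
import Literature.Analysis.FunctionSpaces.SmoothCutoff
import Summits.NavierStokesRegularity.NavierStokesRegularity.Theorems.PoloidalWindowDoorPoloidalWindowRigidityDivFormCaccioppoli
import Summits.NavierStokesRegularity.NavierStokesRegularity.Theorems.PoloidalWindowDoorPoloidalWindowRigidityDivFormCaccioppoliPowers

/-!
# Route `PoloidalWindowDoor`, crux K2 (stmt-NavierStokesRegularity-19708) — task H5, step M3a: the ENERGY side of Moser's
# reverse Hölder step for `div(a∇u) = 0` (towards `divFormLiouville_holds`, De Giorgi–Nash–Moser)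

Seat ns-poloidal-K2-p3 g2 (`ledger fact claim` #1 on `Literature.Analysis.PDE.divFormLiouville`; setting = that fact's
rendering, `w ≥ 1` an entire `C¹` weak solution).  Moser 1961 §4 / Gilbarg–Trudinger Thm 8.18, proof: for a real power
`q ∉ {0, 1}` and a two-radius cutoff `χ` (`χ = 1` on `B(x₀,ρ')`, `χ = 0` off `B(x₀,ρ)`, `‖Dχ‖ ≤ C₀/(ρ−ρ')`), the test
function `φ = χ w^{q/2} ∈ C¹_c(ℝⁿ)` satisfies the energy bound
`λ ∫ ‖Dφ‖² ≤ 2 (λ + (q/(q−1))² nΛ) (C₀/(ρ−ρ'))² ∫_{B(x₀,ρ)} w^q`,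
which the Sobolev inequality (M3b) turns into the reverse Hölder step of the Moser iteration, for `w` (`q > 0`) and for
`w⁻¹` (`q < 0`) alike.

* `exists_ball_cutoff₂` — two-radius ball cutoffs (from `SmoothCutoff.exists_smooth_cutoff`);
* `contDiff_rpow_of_one_le`, `fderiv_rpow_of_one_le`, `norm_fderiv_rpow_half_sq` — calculus of `w^{q/2}`;
* `gradPow_estimate` — `λ ∫ χ² ‖D(w^{q/2})‖² ≤ (q/(q−1))² nΛ ∫ w^q ‖Dχ‖²` (from M1b `caccioppoli_rpow`, `β = q − 1`);
* `energy_testPow_le` — the displayed bound for `φ = χ w^{q/2}`, with the right side an integral over `B(x₀,ρ)`.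

WHAT THIS IS NOT: not yet the Liouville theorem (M3b Sobolev/iteration, M4 Harnack ⇒ Liouville to come); nothing NS-specific.
-/

noncomputable section

open MeasureTheory Set Function Filter Topology Metric
open scoped Matrix ENNReal

-- the summit and its single sub-problem share the name (CONVENTIONS §1), as in every Theorems file
set_option linter.dupNamespace false

namespace Summit.NavierStokesRegularity.NavierStokesRegularity.Theorems.PoloidalWindowDoorPoloidalWindowRigidityDivFormReverseHolder

open Summit.NavierStokesRegularity.NavierStokesRegularity.Theorems.PoloidalWindowDoorPoloidalWindowRigidityDivFormCaccioppoli
open Summit.NavierStokesRegularity.NavierStokesRegularity.Theorems.PoloidalWindowDoorPoloidalWindowRigidityDivFormCaccioppoliPowers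
open Literature.Analysis.FunctionSpaces

variable {n : ℕ}

/-! ### Two-radius cutoffs -/

/-- **Two-radius ball cutoffs.**  There is `C₀ ≥ 0` (depending only on `n`) such that for all `x₀` and `0 < ρ' < ρ`
there is `χ ∈ C¹_c(ℝⁿ)`, `0 ≤ χ ≤ 1`, `χ = 1` on `B(x₀,ρ')`, `χ = 0` off `B(x₀,ρ)`, `‖Dχ‖ ≤ C₀/(ρ − ρ')`. -/
theorem exists_ball_cutoff₂ (n : ℕ) : ∃ C₀ : ℝ, 0 ≤ C₀ ∧ ∀ (x₀ : EuclideanSpace ℝ (Fin n)) (ρ' ρ : ℝ),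
    0 < ρ' → ρ' < ρ →
    ∃ χ : EuclideanSpace ℝ (Fin n) → ℝ, ContDiff ℝ 1 χ ∧ HasCompactSupport χ ∧ (∀ x, 0 ≤ χ x ∧ χ x ≤ 1) ∧
      (∀ x ∈ ball x₀ ρ', χ x = 1) ∧ (∀ x, x ∉ ball x₀ ρ → χ x = 0) ∧ ∀ x, ‖fderiv ℝ χ x‖ ≤ C₀ / (ρ - ρ') := by
  obtain ⟨C, hC0, hC⟩ := exists_smooth_cutoff (volume : Measure (EuclideanSpace ℝ (Fin n)))
  refine ⟨2 * C, by positivity, fun x₀ ρ' ρ hρ' hρ => ?_⟩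
  have hδ : 0 < (ρ - ρ') / 2 := by linarith
  obtain ⟨χ, hχs, hχ01, hχ1, hχ0, hχD⟩ := hC (ball x₀ ((ρ + ρ') / 2)) measurableSet_ball ((ρ - ρ') / 2) hδ
  have hzero : ∀ x, x ∉ ball x₀ ρ → χ x = 0 := by
    intro x hx
    refine hχ0 x (Metric.ball_disjoint_ball ?_)
    rw [mem_ball, not_lt] at hx
    linarith
  refine ⟨χ, hχs.of_le (by norm_cast), ?_, hχ01, fun x hx => hχ1 x ?_, hzero,
    fun x => (hχD x).trans_eq (by field_simp)⟩
  · refine HasCompactSupport.intro (isCompact_closedBall x₀ ρ) fun x hx => hzero x fun hx' => hx ?_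
    exact ball_subset_closedBall hx'
  · rw [mem_ball] at hx
    intro z hz
    rw [mem_ball] at hz ⊢
    calc dist z x₀ ≤ dist z x + dist x x₀ := dist_triangle _ _ _
      _ < (ρ - ρ') / 2 + ρ' := by linarith
      _ = (ρ + ρ') / 2 := by ring

/-! ### Powers of a solution bounded below by `1` -/

variable {w : EuclideanSpace ℝ (Fin n) → ℝ}

/-- `w^s ∈ C¹` for `w ∈ C¹`, `w ≥ 1`. -/
theorem contDiff_rpow_of_one_le (hw : ContDiff ℝ 1 w) (hw1 : ∀ y, 1 ≤ w y) (s : ℝ) :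
    ContDiff ℝ 1 fun y => w y ^ s := by
  rw [contDiff_iff_contDiffAt]
  intro y
  have hy : w y ≠ 0 := (lt_of_lt_of_le one_pos (hw1 y)).ne'
  exact (Real.contDiffAt_rpow_const_of_ne (p := s) (n := 1) hy).comp y hw.contDiffAt

/-- `D(w^s) = s w^{s−1} Dw` for `w ≥ 1`. -/
theorem fderiv_rpow_of_one_le (hw : ContDiff ℝ 1 w) (hw1 : ∀ y, 1 ≤ w y) (s : ℝ) (y : EuclideanSpace ℝ (Fin n)) :
    fderiv ℝ (fun y => w y ^ s) y = (s * w y ^ (s - 1)) • fderiv ℝ w y := by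
  have hy : w y ≠ 0 := (lt_of_lt_of_le one_pos (hw1 y)).ne'
  have h := ((Real.hasDerivAt_rpow_const (p := s) (Or.inl hy))).comp_hasFDerivAt y
    ((hw.differentiable one_ne_zero) y).hasFDerivAt
  rw [show (fun y => w y ^ s) = (fun x : ℝ => x ^ s) ∘ w from rfl, h.fderiv]

/-- `‖D(w^{q/2})‖² = (q/2)² w^{q−2} ‖Dw‖²` for `w ≥ 1`. -/
theorem norm_fderiv_rpow_half_sq (hw : ContDiff ℝ 1 w) (hw1 : ∀ y, 1 ≤ w y) (q : ℝ) (y : EuclideanSpace ℝ (Fin n)) :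
    ‖fderiv ℝ (fun y => w y ^ (q / 2)) y‖ ^ 2 = (q / 2) ^ 2 * w y ^ (q - 2) * ‖fderiv ℝ w y‖ ^ 2 := by
  have hpos : 0 < w y := lt_of_lt_of_le one_pos (hw1 y)
  rw [fderiv_rpow_of_one_le hw hw1, norm_smul, mul_pow, Real.norm_eq_abs, sq_abs, mul_pow]
  have h : (w y ^ (q / 2 - 1)) ^ 2 = w y ^ (q - 2) := by
    rw [← Real.rpow_natCast, ← Real.rpow_mul hpos.le]; congr 1; push_cast; ring
  rw [h]

/-! ### The gradient of `w^{q/2}`: energy estimate -/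

variable {a : EuclideanSpace ℝ (Fin n) → Matrix (Fin n) (Fin n) ℝ} {lam Λ : ℝ}

/-- **Energy estimate for powers** (Moser 1961 (4.5)): for an entire `C¹` weak solution `w ≥ 1`, `q ∉ {0,1}` and
`χ ∈ C¹_c`: `λ ∫ χ² ‖D(w^{q/2})‖² ≤ (q/(q−1))² · nΛ · ∫ w^q ‖Dχ‖²`. -/
theorem gradPow_estimate (hsymm : ∀ y, (a y).IsSymm) (hlam : 0 < lam)
    (hmeas : ∀ i j, Measurable fun y => a y i j)
    (hell : ∀ y (ξ : Fin n → ℝ), lam * (ξ ⬝ᵥ ξ) ≤ ξ ⬝ᵥ (a y *ᵥ ξ)) (hbd : ∀ y i j, |a y i j| ≤ Λ)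
    (hw : ContDiff ℝ 1 w) (hw1 : ∀ y, 1 ≤ w y)
    (hweak : ∀ η : EuclideanSpace ℝ (Fin n) → ℝ, ContDiff ℝ 1 η → HasCompactSupport η →
      ∫ y, ∑ i, ∑ j, a y i j * fderiv ℝ w y (EuclideanSpace.single i 1) *
        fderiv ℝ η y (EuclideanSpace.single j 1) = 0)
    {q : ℝ} (hq0 : q ≠ 0) (hq1 : q ≠ 1)
    {χ : EuclideanSpace ℝ (Fin n) → ℝ} (hχ : ContDiff ℝ 1 χ) (hχc : HasCompactSupport χ) :
    lam * ∫ y, χ y ^ 2 * ‖fderiv ℝ (fun y => w y ^ (q / 2)) y‖ ^ 2 ≤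
      (q / (q - 1)) ^ 2 * (n * Λ) * ∫ y, w y ^ q * ‖fderiv ℝ χ y‖ ^ 2 := by
  have hpos : ∀ y, 0 < w y := fun y => lt_of_lt_of_le one_pos (hw1 y)
  have hβ : q - 1 ≠ 0 := sub_ne_zero.2 hq1
  have hC := caccioppoli_rpow hsymm hlam hmeas hell hbd hw hw1 hweak hβ hχ hχc
  simp only [sub_add_cancel] at hC
  have hcw := continuous_fderiv_single hw
  have hcχ := continuous_fderiv_single hχ
  -- continuity of the weights
  have hwq : ∀ s : ℝ, Continuous fun y => w y ^ s := fun s => (contDiff_rpow_of_one_le hw hw1 s).continuous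
  have hnw : Continuous fun y => ‖fderiv ℝ w y‖ ^ 2 := ((hw.continuous_fderiv one_ne_zero).norm).pow 2
  have hnχ : Continuous fun y => ‖fderiv ℝ χ y‖ ^ 2 := ((hχ.continuous_fderiv one_ne_zero).norm).pow 2
  -- (1) left side: `λ χ² ‖D(w^{q/2})‖² = (q/2)² χ² w^{q−2} · λ‖Dw‖² ≤ (q/2)² χ² w^{(q−1)−1} Q(Dw)`
  have hgC : ContDiff ℝ 1 fun y => w y ^ (q / 2) := contDiff_rpow_of_one_le hw hw1 (q / 2)
  have hng : Continuous fun y => ‖fderiv ℝ (fun y => w y ^ (q / 2)) y‖ ^ 2 :=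
    ((hgC.continuous_fderiv one_ne_zero).norm).pow 2
  have hsuppχ2 : HasCompactSupport fun y => χ y ^ 2 := hχc.comp_left (g := fun s : ℝ => s ^ 2) (by simp)
  have hsuppL : HasCompactSupport fun y => χ y ^ 2 * ‖fderiv ℝ (fun y => w y ^ (q / 2)) y‖ ^ 2 :=
    hsuppχ2.mul_right (f' := fun y => ‖fderiv ℝ (fun y => w y ^ (q / 2)) y‖ ^ 2)
  have hL_int : Integrable fun y => χ y ^ 2 * ‖fderiv ℝ (fun y => w y ^ (q / 2)) y‖ ^ 2 :=
    ((hχ.continuous.pow 2).mul hng).integrable_of_hasCompactSupport hsuppL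
  have hQ_int : Integrable fun y => χ y ^ 2 * w y ^ (q - 1 - 1) *
      ((fun i => fderiv ℝ w y (EuclideanSpace.single i 1)) ⬝ᵥ
        (a y *ᵥ fun i => fderiv ℝ w y (EuclideanSpace.single i 1))) := by
    have h' := integrable_mul_of_le_continuous (n := n)
      (m := fun y => (fun i => fderiv ℝ w y (EuclideanSpace.single i 1)) ⬝ᵥ
        (a y *ᵥ fun i => fderiv ℝ w y (EuclideanSpace.single i 1)))
      (M := fun y => n * Λ * (∑ i, fderiv ℝ w y (EuclideanSpace.single i 1) ^ 2 +
        ∑ j, fderiv ℝ w y (EuclideanSpace.single j 1) ^ 2) / 2)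
      (φ := fun y => χ y ^ 2 * w y ^ (q - 1 - 1))
      (measurable_dotProduct_mulVec hmeas hcw hcw) (by fun_prop)
      (fun y => abs_dotProduct_mulVec_le hsymm hlam hell hbd y _ _) ((hχ.continuous.pow 2).mul (hwq _))
      (hasCompactSupport_testFun (u := w) (g := fun s => s ^ (q - 1 - 1)) hχc)
    exact h'.congr (Eventually.of_forall fun y => by ring)
  have hL : lam * ∫ y, χ y ^ 2 * ‖fderiv ℝ (fun y => w y ^ (q / 2)) y‖ ^ 2 ≤
      (q / 2) ^ 2 * ∫ y, χ y ^ 2 * w y ^ (q - 1 - 1) *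
        ((fun i => fderiv ℝ w y (EuclideanSpace.single i 1)) ⬝ᵥ
          (a y *ᵥ fun i => fderiv ℝ w y (EuclideanSpace.single i 1))) := by
    rw [← integral_const_mul, ← integral_const_mul]
    refine integral_mono (hL_int.const_mul lam) (hQ_int.const_mul _) fun y => ?_
    have hq := quadForm_lower hell y (fun i => fderiv ℝ w y (EuclideanSpace.single i 1))
    rw [sum_fderiv_single_sq] at hq
    rw [norm_fderiv_rpow_half_sq hw hw1 q y, show q - 1 - 1 = q - 2 by ring]
    have hw0 : 0 ≤ χ y ^ 2 * w y ^ (q - 2) * (q / 2) ^ 2 :=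
      mul_nonneg (mul_nonneg (sq_nonneg _) (Real.rpow_nonneg (hpos y).le _)) (sq_nonneg _)
    have hm := mul_le_mul_of_nonneg_left hq hw0
    calc lam * (χ y ^ 2 * ((q / 2) ^ 2 * w y ^ (q - 2) * ‖fderiv ℝ w y‖ ^ 2))
        = χ y ^ 2 * w y ^ (q - 2) * (q / 2) ^ 2 * (lam * ‖fderiv ℝ w y‖ ^ 2) := by ring
      _ ≤ χ y ^ 2 * w y ^ (q - 2) * (q / 2) ^ 2 *
          ((fun i => fderiv ℝ w y (EuclideanSpace.single i 1)) ⬝ᵥ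
            (a y *ᵥ fun i => fderiv ℝ w y (EuclideanSpace.single i 1))) := hm
      _ = (q / 2) ^ 2 * (χ y ^ 2 * w y ^ (q - 2) *
          ((fun i => fderiv ℝ w y (EuclideanSpace.single i 1)) ⬝ᵥ
            (a y *ᵥ fun i => fderiv ℝ w y (EuclideanSpace.single i 1)))) := by ring
  -- (2) right side: `Q(Dχ) ≤ nΛ ‖Dχ‖²`
  have hR_int : Integrable fun y => w y ^ q * ‖fderiv ℝ χ y‖ ^ 2 := by
    refine ((hwq q).mul hnχ).integrable_of_hasCompactSupport ?_
    exact ((hχc.fderiv (𝕜 := ℝ)).norm.comp_left (g := fun s : ℝ => s ^ 2) (by simp)).mul_left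
  have hRq_int : Integrable fun y => w y ^ q *
      ((fun j => fderiv ℝ χ y (EuclideanSpace.single j 1)) ⬝ᵥ
        (a y *ᵥ fun j => fderiv ℝ χ y (EuclideanSpace.single j 1))) := by
    refine (hR_int.const_mul (n * Λ)).mono'
      ((hwq q).aestronglyMeasurable.mul (measurable_dotProduct_mulVec hmeas hcχ hcχ).aestronglyMeasurable)
      (Eventually.of_forall fun y => ?_)
    have hq0' : 0 ≤ ((fun j => fderiv ℝ χ y (EuclideanSpace.single j 1)) ⬝ᵥ
        (a y *ᵥ fun j => fderiv ℝ χ y (EuclideanSpace.single j 1))) :=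
      (mul_nonneg hlam.le (Finset.sum_nonneg fun i _ => sq_nonneg _)).trans (quadForm_lower hell y _)
    have hup := quadForm_upper hbd y (fun j => fderiv ℝ χ y (EuclideanSpace.single j 1))
    rw [sum_fderiv_single_sq] at hup
    rw [Real.norm_eq_abs, abs_of_nonneg (mul_nonneg (Real.rpow_nonneg (hpos y).le _) hq0')]
    calc w y ^ q * ((fun j => fderiv ℝ χ y (EuclideanSpace.single j 1)) ⬝ᵥ
          (a y *ᵥ fun j => fderiv ℝ χ y (EuclideanSpace.single j 1)))
        ≤ w y ^ q * (n * Λ * ‖fderiv ℝ χ y‖ ^ 2) := mul_le_mul_of_nonneg_left hup (Real.rpow_nonneg (hpos y).le _)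
      _ = n * Λ * (w y ^ q * ‖fderiv ℝ χ y‖ ^ 2) := by ring
  have hR : ∫ y, w y ^ q * ((fun j => fderiv ℝ χ y (EuclideanSpace.single j 1)) ⬝ᵥ
        (a y *ᵥ fun j => fderiv ℝ χ y (EuclideanSpace.single j 1))) ≤
      n * Λ * ∫ y, w y ^ q * ‖fderiv ℝ χ y‖ ^ 2 := by
    rw [← integral_const_mul]
    refine integral_mono hRq_int (hR_int.const_mul _) fun y => ?_
    have hup := quadForm_upper hbd y (fun j => fderiv ℝ χ y (EuclideanSpace.single j 1))
    rw [sum_fderiv_single_sq] at hup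
    calc w y ^ q * ((fun j => fderiv ℝ χ y (EuclideanSpace.single j 1)) ⬝ᵥ
          (a y *ᵥ fun j => fderiv ℝ χ y (EuclideanSpace.single j 1)))
        ≤ w y ^ q * (n * Λ * ‖fderiv ℝ χ y‖ ^ 2) := mul_le_mul_of_nonneg_left hup (Real.rpow_nonneg (hpos y).le _)
      _ = n * Λ * (w y ^ q * ‖fderiv ℝ χ y‖ ^ 2) := by ring
  -- assemble: `λ∫χ²‖Dg‖² ≤ (q/2)² · (4/(q−1)²) ∫ w^q Q(Dχ) ≤ (q/(q−1))² nΛ ∫ w^q ‖Dχ‖²`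
  have hq2 : 0 ≤ (q / 2) ^ 2 := sq_nonneg _
  calc lam * ∫ y, χ y ^ 2 * ‖fderiv ℝ (fun y => w y ^ (q / 2)) y‖ ^ 2
      ≤ (q / 2) ^ 2 * ∫ y, χ y ^ 2 * w y ^ (q - 1 - 1) *
          ((fun i => fderiv ℝ w y (EuclideanSpace.single i 1)) ⬝ᵥ
            (a y *ᵥ fun i => fderiv ℝ w y (EuclideanSpace.single i 1))) := hL
    _ ≤ (q / 2) ^ 2 * (4 / (q - 1) ^ 2 * ∫ y, w y ^ q *
          ((fun j => fderiv ℝ χ y (EuclideanSpace.single j 1)) ⬝ᵥ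
            (a y *ᵥ fun j => fderiv ℝ χ y (EuclideanSpace.single j 1)))) :=
        mul_le_mul_of_nonneg_left hC hq2
    _ ≤ (q / 2) ^ 2 * (4 / (q - 1) ^ 2 * (n * Λ * ∫ y, w y ^ q * ‖fderiv ℝ χ y‖ ^ 2)) :=
        mul_le_mul_of_nonneg_left (mul_le_mul_of_nonneg_left hR (by positivity)) hq2
    _ = (q / (q - 1)) ^ 2 * (n * Λ) * ∫ y, w y ^ q * ‖fderiv ℝ χ y‖ ^ 2 := by
        field_simp
        ring


/-! ### The test function `φ = χ w^{q/2}` -/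

/-- `‖D(χ g)‖² ≤ 2 (χ² ‖Dg‖² + g² ‖Dχ‖²)`. -/
theorem norm_fderiv_mul_sq_le {χ g : EuclideanSpace ℝ (Fin n) → ℝ} (hχ : ContDiff ℝ 1 χ) (hg : ContDiff ℝ 1 g)
    (y : EuclideanSpace ℝ (Fin n)) :
    ‖fderiv ℝ (fun y => χ y * g y) y‖ ^ 2 ≤ 2 * (χ y ^ 2 * ‖fderiv ℝ g y‖ ^ 2 + g y ^ 2 * ‖fderiv ℝ χ y‖ ^ 2) := by
  have hχd : DifferentiableAt ℝ χ y := (hχ.differentiable one_ne_zero) y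
  have hgd : DifferentiableAt ℝ g y := (hg.differentiable one_ne_zero) y
  rw [fderiv_fun_mul hχd hgd]
  have h1 : ‖χ y • fderiv ℝ g y + g y • fderiv ℝ χ y‖ ≤ |χ y| * ‖fderiv ℝ g y‖ + |g y| * ‖fderiv ℝ χ y‖ := by
    refine (norm_add_le _ _).trans (le_of_eq ?_)
    rw [norm_smul, norm_smul, Real.norm_eq_abs, Real.norm_eq_abs]
  have h0 : 0 ≤ |χ y| * ‖fderiv ℝ g y‖ + |g y| * ‖fderiv ℝ χ y‖ := by positivity
  calc ‖χ y • fderiv ℝ g y + g y • fderiv ℝ χ y‖ ^ 2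
      ≤ (|χ y| * ‖fderiv ℝ g y‖ + |g y| * ‖fderiv ℝ χ y‖) ^ 2 := pow_le_pow_left₀ (norm_nonneg _) h1 2
    _ ≤ 2 * (χ y ^ 2 * ‖fderiv ℝ g y‖ ^ 2 + g y ^ 2 * ‖fderiv ℝ χ y‖ ^ 2) := by
        rw [← sq_abs (χ y), ← sq_abs (g y)]
        nlinarith [sq_nonneg (|χ y| * ‖fderiv ℝ g y‖ - |g y| * ‖fderiv ℝ χ y‖)]

/-- **Energy of the Moser test function.**  For an entire `C¹` weak solution `w ≥ 1`, `q ∉ {0,1}`, and a two-radius cutoff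
`χ` of `B(x₀,ρ') ⊂ B(x₀,ρ)` with `‖Dχ‖ ≤ C₀/(ρ−ρ')` and `χ = 0` off `B(x₀,ρ)`:
`λ ∫ ‖D(χ w^{q/2})‖² ≤ 2 ((q/(q−1))² nΛ + λ) (C₀/(ρ−ρ'))² ∫_{B̄(x₀,ρ)} w^q`. -/
theorem energy_testPow_le (hsymm : ∀ y, (a y).IsSymm) (hlam : 0 < lam)
    (hmeas : ∀ i j, Measurable fun y => a y i j)
    (hell : ∀ y (ξ : Fin n → ℝ), lam * (ξ ⬝ᵥ ξ) ≤ ξ ⬝ᵥ (a y *ᵥ ξ)) (hbd : ∀ y i j, |a y i j| ≤ Λ)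
    (hw : ContDiff ℝ 1 w) (hw1 : ∀ y, 1 ≤ w y)
    (hweak : ∀ η : EuclideanSpace ℝ (Fin n) → ℝ, ContDiff ℝ 1 η → HasCompactSupport η →
      ∫ y, ∑ i, ∑ j, a y i j * fderiv ℝ w y (EuclideanSpace.single i 1) *
        fderiv ℝ η y (EuclideanSpace.single j 1) = 0)
    {q : ℝ} (hq0 : q ≠ 0) (hq1 : q ≠ 1) {x₀ : EuclideanSpace ℝ (Fin n)} {ρ' ρ C₀ : ℝ}
    {χ : EuclideanSpace ℝ (Fin n) → ℝ} (hχ : ContDiff ℝ 1 χ) (hχc : HasCompactSupport χ)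
    (hχ0 : ∀ x, x ∉ ball x₀ ρ → χ x = 0) (hχD : ∀ x, ‖fderiv ℝ χ x‖ ≤ C₀ / (ρ - ρ')) :
    lam * ∫ y, ‖fderiv ℝ (fun y => χ y * w y ^ (q / 2)) y‖ ^ 2 ≤
      2 * ((q / (q - 1)) ^ 2 * (n * Λ) + lam) * (C₀ / (ρ - ρ')) ^ 2 * ∫ y in closedBall x₀ ρ, w y ^ q := by
  have hpos : ∀ y, 0 < w y := fun y => lt_of_lt_of_le one_pos (hw1 y)
  have hG := gradPow_estimate hsymm hlam hmeas hell hbd hw hw1 hweak hq0 hq1 hχ hχc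
  have hgC : ContDiff ℝ 1 fun y => w y ^ (q / 2) := contDiff_rpow_of_one_le hw hw1 (q / 2)
  have hwq : ∀ s : ℝ, Continuous fun y => w y ^ s := fun s => (contDiff_rpow_of_one_le hw hw1 s).continuous
  have hng : Continuous fun y => ‖fderiv ℝ (fun y => w y ^ (q / 2)) y‖ ^ 2 :=
    ((hgC.continuous_fderiv one_ne_zero).norm).pow 2
  have hnχ : Continuous fun y => ‖fderiv ℝ χ y‖ ^ 2 := ((hχ.continuous_fderiv one_ne_zero).norm).pow 2
  have hg2 : ∀ y, (w y ^ (q / 2)) ^ 2 = w y ^ q := fun y => by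
    rw [← Real.rpow_natCast, ← Real.rpow_mul (hpos y).le]; congr 1; push_cast; ring
  -- compact supports
  have hsuppχ2 : HasCompactSupport fun y => χ y ^ 2 := hχc.comp_left (g := fun s : ℝ => s ^ 2) (by simp)
  have hsuppDχ : HasCompactSupport fun y => ‖fderiv ℝ χ y‖ ^ 2 :=
    (hχc.fderiv (𝕜 := ℝ)).norm.comp_left (g := fun s : ℝ => s ^ 2) (by simp)
  have hsuppφ : HasCompactSupport fun y => χ y * w y ^ (q / 2) := hχc.mul_right (f' := fun y => w y ^ (q / 2))
  -- integrability
  have hI1 : Integrable fun y => χ y ^ 2 * ‖fderiv ℝ (fun y => w y ^ (q / 2)) y‖ ^ 2 :=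
    ((hχ.continuous.pow 2).mul hng).integrable_of_hasCompactSupport
      (hsuppχ2.mul_right (f' := fun y => ‖fderiv ℝ (fun y => w y ^ (q / 2)) y‖ ^ 2))
  have hI2 : Integrable fun y => w y ^ q * ‖fderiv ℝ χ y‖ ^ 2 :=
    ((hwq q).mul hnχ).integrable_of_hasCompactSupport (hsuppDχ.mul_left (f := fun y => w y ^ q))
  have hφC : ContDiff ℝ 1 fun y => χ y * w y ^ (q / 2) := hχ.mul hgC
  have hnφ : Continuous fun y => ‖fderiv ℝ (fun y => χ y * w y ^ (q / 2)) y‖ ^ 2 :=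
    ((hφC.continuous_fderiv one_ne_zero).norm).pow 2
  have hsuppDφ0 : HasCompactSupport (fderiv ℝ fun y => χ y * w y ^ (q / 2)) := hsuppφ.fderiv (𝕜 := ℝ)
  have hsuppDφ : HasCompactSupport fun y => ‖fderiv ℝ (fun y => χ y * w y ^ (q / 2)) y‖ ^ 2 := by
    refine hsuppDφ0.norm.mono (Function.support_subset_iff'.2 fun y hy => ?_)
    simp only [Function.mem_support, not_not] at hy
    simp [hy]
  have hIφ : Integrable fun y => ‖fderiv ℝ (fun y => χ y * w y ^ (q / 2)) y‖ ^ 2 :=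
    hnφ.integrable_of_hasCompactSupport hsuppDφ
  -- (1) `∫ ‖Dφ‖² ≤ 2 ∫ χ²‖Dg‖² + 2 ∫ w^q ‖Dχ‖²`
  have h1 : ∫ y, ‖fderiv ℝ (fun y => χ y * w y ^ (q / 2)) y‖ ^ 2 ≤
      2 * (∫ y, χ y ^ 2 * ‖fderiv ℝ (fun y => w y ^ (q / 2)) y‖ ^ 2) + 2 * (∫ y, w y ^ q * ‖fderiv ℝ χ y‖ ^ 2) := by
    rw [← integral_const_mul, ← integral_const_mul, ← integral_add (hI1.const_mul 2) (hI2.const_mul 2)]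
    refine integral_mono hIφ ((hI1.const_mul 2).add (hI2.const_mul 2)) fun y => ?_
    have h := norm_fderiv_mul_sq_le hχ hgC y
    rw [hg2 y] at h
    simp only
    linarith
  -- (2) `∫ w^q ‖Dχ‖² ≤ (C₀/(ρ−ρ'))² ∫_{B̄(x₀,ρ)} w^q`
  have hDχ_out : ∀ x, x ∉ closedBall x₀ ρ → fderiv ℝ χ x = 0 := by
    intro x hx
    have hev : χ =ᶠ[𝓝 x] fun _ => 0 := by
      filter_upwards [isClosed_closedBall.isOpen_compl.mem_nhds hx] with z hz
      exact hχ0 z fun hz' => hz (ball_subset_closedBall hz')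
    rw [hev.fderiv_eq, fderiv_const_apply]
  have h2 : ∫ y, w y ^ q * ‖fderiv ℝ χ y‖ ^ 2 ≤ (C₀ / (ρ - ρ')) ^ 2 * ∫ y in closedBall x₀ ρ, w y ^ q := by
    have heq : ∫ y, w y ^ q * ‖fderiv ℝ χ y‖ ^ 2 = ∫ y in closedBall x₀ ρ, w y ^ q * ‖fderiv ℝ χ y‖ ^ 2 := by
      refine (setIntegral_eq_integral_of_forall_compl_eq_zero fun y hy => ?_).symm
      rw [hDχ_out y hy, norm_zero, zero_pow two_ne_zero, mul_zero]
    rw [heq, ← integral_const_mul]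
    have hIw : IntegrableOn (fun y => w y ^ q) (closedBall x₀ ρ) :=
      (hwq q).continuousOn.integrableOn_compact (isCompact_closedBall _ _)
    refine setIntegral_mono_on hI2.integrableOn (hIw.const_mul _) measurableSet_closedBall fun y _ => ?_
    have hwq0 : 0 ≤ w y ^ q := Real.rpow_nonneg (hpos y).le _
    calc w y ^ q * ‖fderiv ℝ χ y‖ ^ 2 ≤ w y ^ q * (C₀ / (ρ - ρ')) ^ 2 :=
          mul_le_mul_of_nonneg_left (pow_le_pow_left₀ (norm_nonneg _) (hχD y) 2) hwq0
      _ = (C₀ / (ρ - ρ')) ^ 2 * w y ^ q := mul_comm _ _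
  -- assemble
  have hI0 : 0 ≤ ∫ y in closedBall x₀ ρ, w y ^ q :=
    setIntegral_nonneg measurableSet_closedBall fun y _ => Real.rpow_nonneg (hpos y).le _
  have hnΛq : 0 ≤ (q / (q - 1)) ^ 2 * (n * Λ) := by
    rcases Nat.eq_zero_or_pos n with hn | hn
    · simp [hn]
    · exact mul_nonneg (sq_nonneg _) (mul_nonneg (Nat.cast_nonneg n) ((abs_nonneg _).trans (hbd x₀ ⟨0, hn⟩ ⟨0, hn⟩)))
  calc lam * ∫ y, ‖fderiv ℝ (fun y => χ y * w y ^ (q / 2)) y‖ ^ 2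
      ≤ lam * (2 * (∫ y, χ y ^ 2 * ‖fderiv ℝ (fun y => w y ^ (q / 2)) y‖ ^ 2) +
          2 * (∫ y, w y ^ q * ‖fderiv ℝ χ y‖ ^ 2)) := mul_le_mul_of_nonneg_left h1 hlam.le
    _ = 2 * (lam * ∫ y, χ y ^ 2 * ‖fderiv ℝ (fun y => w y ^ (q / 2)) y‖ ^ 2) +
          2 * lam * (∫ y, w y ^ q * ‖fderiv ℝ χ y‖ ^ 2) := by ring
    _ ≤ 2 * ((q / (q - 1)) ^ 2 * (n * Λ) * ∫ y, w y ^ q * ‖fderiv ℝ χ y‖ ^ 2) +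
          2 * lam * (∫ y, w y ^ q * ‖fderiv ℝ χ y‖ ^ 2) := by
        have := mul_le_mul_of_nonneg_left hG (by norm_num : (0 : ℝ) ≤ 2)
        linarith
    _ = 2 * ((q / (q - 1)) ^ 2 * (n * Λ) + lam) * ∫ y, w y ^ q * ‖fderiv ℝ χ y‖ ^ 2 := by ring
    _ ≤ 2 * ((q / (q - 1)) ^ 2 * (n * Λ) + lam) * ((C₀ / (ρ - ρ')) ^ 2 * ∫ y in closedBall x₀ ρ, w y ^ q) :=
        mul_le_mul_of_nonneg_left h2 (by positivity)
    _ = 2 * ((q / (q - 1)) ^ 2 * (n * Λ) + lam) * (C₀ / (ρ - ρ')) ^ 2 * ∫ y in closedBall x₀ ρ, w y ^ q := by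
        ring

end Summit.NavierStokesRegularity.NavierStokesRegularity.Theorems.PoloidalWindowDoorPoloidalWindowRigidityDivFormReverseHolder

end
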